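import Summits.Ventures.LatticeQCDFlow.Scaling.ReplicaExchangeModeGap
import Summits.Ventures.LatticeQCDFlow.Scaling.SimulatedTemperingFrozenCold

/-!
HONEST FRAMING: exact (Metropolis-corrected) sampling algorithms for lattice gauge theory; figures
of merit are autocorrelation/cost numbers at stated couplings and volumes; no continuum-physics
claim.

# ReplicaExchangeFrozenCold — WITH A FAST HOT REPLICA AND POINTWISE TWO-SIDED PERSISTENCE THE COLD REPLICAS' OWN
# DYNAMICS DO NOT MATTER: `Gap(ptBareSampler ½ μ M) ≥ p q^K·min{1/K², γ₀/(K+1)}/(96(K+1)²)` FOR ARBITRARY (EVEN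
# IDENTITY) REVERSIBLE COLD UPDATES; IRREDUCIBILITY FROM THE HOT REPLICA ALONE; `τ_int` FOR EVERY OBSERVABLE
# (lean-2 GEN-18, ours)

Venture-side (OURS).  Cell `lqcd-flow` (pub-lqcd), unit `pub-lqcd-lean-2-g18`, 2026-08-25.  Chapter R, file 6 — the
replica-exchange counterpart of `Scaling/SimulatedTemperingFrozenCold` (GEN-17, Y6): the extreme instance `mode = id`
of `Scaling/ReplicaExchangeModeGap` (every configuration its own mode).  Then the within-mode gaps are vacuous
(`γ_A = 1`: point masses have no variance), the assignment-restricted swap overlap is EXACTLY `δ₂ = 1` (a singleton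
block), and what remains is: the hot replica's global Poincaré constant `γ₀`, POINTWISE persistence
`p·μ_k(x) ≤ μ_i(x)` (`i ≤ k`) and pointwise one-level cooling `q·μ_l(x) ≤ μ_{l+1}(x)`.

## What is proved

* §1 `modes_id_block`, `ptBareId_hδ` (`δ₂ = 1` exactly); **`ptBareFrozen_spectralGap_ge`** —
  `Gap(ptBareSampler ½ μ M) ≥ p q^K·min{1/K², γ₀/(K+1)}/(96(K+1)²)`, the `M_k` (`k ≥ 1`) being ANY row-stochastic
  `μ_k`-reversible matrices (`K ≥ 1`, `p, q ≤ 1`).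
* (§2, irreducibility from the hot update alone, now lives in `Scaling/ReplicaExchangeBareErgodic`:
  `ptBareSampler_isIrreducible_of_hot`, the conveyor identity `update x (l+1) v = (update (x∘σ_l) l v)∘σ_l`.)
* §3 **`ptBareFrozen_tauInt_le`** — `τ_int(g) ≤ 96(K+1)²/(p q^K·min{1/K², γ₀/(K+1)}) − ½` for every non-constant
  observable of the replica configurations, irreducible hot update, arbitrary cold updates.
* §4 **`ptBarePerfectHot_spectralGap_ge`** — a PERFECT hot replica (`M_0(u,·) = μ_0`, the ideal of a trivializing flow at
  the hot end; `γ₀ = 1`) and arbitrary cold updates: `Gap ≥ p q^K·min{1/K², 1/(K+1)}/(96(K+1)²)`.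

Reading (no numerics implied): for PTBC this is the statement that topological freezing of the periodic replicas
is irrelevant to the exact sampler's autocorrelations once ONE replica (open boundary) decorrelates and the swap
ladder persists; the price is polynomial in the number of replicas times `1/(p q^K)`.  NOT CLAIMED: sharp constants;
anything measured.  Literature grade (cell rule): KNOWN MECHANISM (Woodard–Schmidler–Huber 2009), NEW TYPING;
nothing cited as a fact; no new bib keys.
-/

noncomputable section

open Finset Function
open Literature.Probability.MarkovChains
open Literature.Probability.MarkovChains.Decomposition

namespace Summit.Ventures.LatticeQCDFlow.Scaling

section Frozen

variable {S : Type*} [Fintype S] [DecidableEq S] {K : ℕ} {μ : Fin (K + 1) → S → ℝ}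
  {M : Fin (K + 1) → S → S → ℝ} {t : ℝ}

/-! ## §1 `mode = id`: singleton blocks, `δ₂ = 1`, the gap -/

omit [Fintype S] in
/-- The assignment block of `m` under `mode = id` is `{m}`. [ours] -/
theorem modes_id_block [Fintype S] (m : Fin (K + 1) → S) :
    block (fun z : Fin (K + 1) → S => (id : S → S) ∘ z) m = {m} := by
  ext x; simp [block]

/-- Its mass is `π̃(m)`. [ours] -/
theorem modes_id_blockMass (m : Fin (K + 1) → S) :
    blockMass (tensorFun μ) (fun z : Fin (K + 1) → S => (id : S → S) ∘ z) m = tensorFun μ m := by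
  unfold blockMass; rw [modes_id_block, sum_singleton]

/-- **`hδ` with `δ₂ = 1`, exactly:** the block sum is the single term `min{π̃(m), π̃(m∘σ_l)}`. [ours] -/
theorem ptBareId_hδ (m : Fin (K + 1) → S) (l : Fin K) :
    (1 : ℝ) * min (blockMass (tensorFun μ) (fun z : Fin (K + 1) → S => (id : S → S) ∘ z) m)
        (blockMass (tensorFun μ) (fun z : Fin (K + 1) → S => (id : S → S) ∘ z) (m ∘ levelSwap l))
      ≤ ∑ x ∈ block (fun z : Fin (K + 1) → S => (id : S → S) ∘ z) m,
          min (tensorFun μ x) (tensorFun μ (x ∘ levelSwap l)) := by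
  rw [one_mul, modes_id_blockMass, modes_id_block, sum_singleton]
  have e : (m ∘ levelSwap l : Fin (K + 1) → S) = (id : S → S) ∘ (m ∘ levelSwap l) := rfl
  rw [e, ← Function.comp_assoc, modes_id_blockMass]

/-- **WITH A FAST HOT REPLICA AND POINTWISE TWO-SIDED PERSISTENCE THE COLD UPDATES DO NOT MATTER:**
`Gap(ptBareSampler ½ μ M) ≥ p q^K·min{1/K², γ₀/(K+1)}/(96(K+1)²)`, the `M_k` being ANY row-stochastic `μ_k`-reversible
matrices and `γ₀` a Poincaré constant of the hot update `M_0` for `μ_0`. [ours] -/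
theorem ptBareFrozen_spectralGap_ge [Nontrivial S] (hK : 1 ≤ K) (hμ : ∀ k x, 0 < μ k x)
    (hμ1 : ∀ k, ∑ x, μ k x = 1) (hM : ∀ k, IsRowStochastic (M k)) (hMrev : ∀ k, DetailedBalance (μ k) (M k))
    {p q γ₀ : ℝ} (hp : 0 < p) (hp1 : p ≤ 1) (hq0 : 0 < q) (hq1 : q ≤ 1) (hγ₀ : 0 < γ₀)
    (hpers : ∀ (i k : Fin (K + 1)) (x : S), i ≤ k → p * μ k x ≤ μ i x)
    (hq : ∀ (l : Fin K) (x : S), q * μ l.castSucc x ≤ μ l.succ x)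
    (hgap0 : ∀ h : S → ℝ, γ₀ * lawVariance (μ 0) h ≤ dirichletForm (μ 0) (M 0) h) :
    p * q ^ K * min (1 / (K : ℝ) ^ 2) (γ₀ / (K + 1)) / (96 * (K + 1) ^ 2)
      ≤ spectralGap (tensorFun μ) (ptBareSampler (1 / 2) μ M) := by
  have h := ptBareModeHalf_spectralGap_ge_of_hotGap (μ := μ) (M := M) (mode := (id : S → S)) hμ hμ1
    Function.surjective_id hK hM hMrev hp hp1 hq0 hq1 one_pos le_rfl hγ₀ one_pos le_rfl
    (fun i k x hik => by rw [blockMass_id, blockMass_id]; exact hpers i k x hik)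
    (fun l x => by rw [blockMass_id, blockMass_id]; exact hq l x)
    (fun m l _ => ptBareId_hδ m l) hgap0
    (fun k x h => by
      rw [lawVariance_blockLaw_id (hμ k) x h, mul_zero]
      exact dirichletForm_nonneg (blockLaw_nonneg (fun y => (hμ k y).le) _ _)
        (restrictionChain_isRowStochastic (hM k) _).1 h)
  simpa using h

/-! ## §3 The ceiling for every observable -/

/-- **`τ_int(g) ≤ 96(K+1)²/(p q^K·min{1/K², γ₀/(K+1)}) − ½`** for every non-constant observable of the replica
configurations: irreducible hot update with Poincaré constant `γ₀`, ARBITRARY reversible cold updates, pointwise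
two-sided persistence. [ours] -/
theorem ptBareFrozen_tauInt_le [Nontrivial S] (hK : 1 ≤ K) (hμ : ∀ k x, 0 < μ k x)
    (hμ1 : ∀ k, ∑ x, μ k x = 1) (hM : ∀ k, IsRowStochastic (M k)) (hMrev : ∀ k, DetailedBalance (μ k) (M k))
    (hM0 : IsIrreducible (M 0)) {p q γ₀ : ℝ} (hp : 0 < p) (hp1 : p ≤ 1) (hq0 : 0 < q) (hq1 : q ≤ 1) (hγ₀ : 0 < γ₀)
    (hpers : ∀ (i k : Fin (K + 1)) (x : S), i ≤ k → p * μ k x ≤ μ i x)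
    (hq : ∀ (l : Fin K) (x : S), q * μ l.castSucc x ≤ μ l.succ x)
    (hgap0 : ∀ h : S → ℝ, γ₀ * lawVariance (μ 0) h ≤ dirichletForm (μ 0) (M 0) h)
    {g : (Fin (K + 1) → S) → ℝ} (hg : 0 < lawVariance (tensorFun μ) g) :
    asympVar g (tensorFun μ) (ptBareSampler (1 / 2) μ M) / (2 * lawVariance (tensorFun μ) g)
      ≤ 96 * (K + 1) ^ 2 / (p * q ^ K * min (1 / (K : ℝ) ^ 2) (γ₀ / (K + 1))) - 1 / 2 := by
  have ht0 : (0 : ℝ) < 1 / 2 := by norm_num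
  have ht1 : (1 / 2 : ℝ) < 1 := by norm_num
  have hP := ptBareSampler_isRowStochastic (M := M) hμ hM ht0.le ht1.le
  have hDB := ptBareSampler_detailedBalance (t := (1 / 2 : ℝ)) (M := M) hμ hMrev
  have hirr := ptBareSampler_isIrreducible_of_hot hμ hM hM0 ht0 ht1
  have h1 := asympVar_le_spectralGap (tensorFun_pos hμ) (sum_tensorFun_eq_one μ hμ1) hP hDB hirr g
  have hc := ptBareFrozen_spectralGap_ge hK hμ hμ1 hM hMrev hp hp1 hq0 hq1 hγ₀ hpers hq hgap0
  have hKr : (1 : ℝ) ≤ K := by exact_mod_cast hK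
  set c := p * q ^ K * min (1 / (K : ℝ) ^ 2) (γ₀ / (K + 1)) / (96 * (K + 1) ^ 2) with hcdef
  have hm : 0 < min (1 / (K : ℝ) ^ 2) (γ₀ / (K + 1)) := lt_min (by positivity) (div_pos hγ₀ (by positivity))
  have hcpos : 0 < c := by positivity
  have h2 : asympVar g (tensorFun μ) (ptBareSampler (1 / 2) μ M) ≤ (2 / c - 1) * lawVariance (tensorFun μ) g := by
    refine h1.trans (mul_le_mul_of_nonneg_right ?_ hg.le)
    have := div_le_div_of_nonneg_left (by norm_num : (0 : ℝ) ≤ 2) hcpos hc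
    linarith
  rw [div_le_iff₀ (by positivity)]
  have e : (96 * (K + 1) ^ 2 / (p * q ^ K * min (1 / (K : ℝ) ^ 2) (γ₀ / (K + 1))) - 1 / 2)
        * (2 * lawVariance (tensorFun μ) g)
      = (2 / c - 1) * lawVariance (tensorFun μ) g := by
    rw [hcdef]
    field_simp
  rw [e]
  exact h2

/-! ## §4 A perfect hot replica -/

/-- **A PERFECT HOT REPLICA (an independent draw from `μ_0` at every hot update — the ideal of a trivializing flow at the
hot end) AND ARBITRARY COLD UPDATES:** `Gap(ptBareSampler ½ μ M) ≥ p q^K·min{1/K², 1/(K+1)}/(96(K+1)²)`. [ours] -/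
theorem ptBarePerfectHot_spectralGap_ge [Nontrivial S] (hK : 1 ≤ K) (hμ : ∀ k x, 0 < μ k x)
    (hμ1 : ∀ k, ∑ x, μ k x = 1) (hM : ∀ k, IsRowStochastic (M k)) (hMrev : ∀ k, DetailedBalance (μ k) (M k))
    (hM0 : ∀ u v, M 0 u v = μ 0 v) {p q : ℝ} (hp : 0 < p) (hp1 : p ≤ 1) (hq0 : 0 < q) (hq1 : q ≤ 1)
    (hpers : ∀ (i k : Fin (K + 1)) (x : S), i ≤ k → p * μ k x ≤ μ i x)
    (hq : ∀ (l : Fin K) (x : S), q * μ l.castSucc x ≤ μ l.succ x) :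
    p * q ^ K * min (1 / (K : ℝ) ^ 2) ((1 : ℝ) / (K + 1)) / (96 * (K + 1) ^ 2)
      ≤ spectralGap (tensorFun μ) (ptBareSampler (1 / 2) μ M) := by
  have hlim : M 0 = limitMatrix (μ 0) := by
    funext u v; rw [hM0]; rfl
  have hgap0 : ∀ h : S → ℝ, (1 : ℝ) * lawVariance (μ 0) h ≤ dirichletForm (μ 0) (M 0) h := fun h => by
    rw [one_mul, hlim, dirichletForm_limitMatrix (hμ1 0)]
  exact ptBareFrozen_spectralGap_ge hK hμ hμ1 hM hMrev hp hp1 hq0 hq1 one_pos hpers hq hgap0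

end Frozen

end Summit.Ventures.LatticeQCDFlow.Scaling
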